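import Mathlib
import HarnessLib
import Summits.Ventures.LatticeQCDFlow.Exactness.NCMCGeneralSpaceMarkovErgodicCriteria
import Summits.Ventures.LatticeQCDFlow.Exactness.WilsonHeatBathErgodic

/-!
# End to end: with the heat-bath link sweep as level sampler, the engine's correlated-start Jarzynski estimate for the torus Wilson theory converges to `ΔF` almost surely

HONEST FRAMING: exact (Metropolis-corrected) sampling algorithms for lattice gauge theory;
figures of merit are autocorrelation/cost numbers at stated couplings and volumes; no
continuum-physics claim.

Venture `LatticeQCDFlow` (cell pub-lqcd), topic `Exactness`; FANOUT row 13 (`eng-snf`, GEN-16).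
NEW WORK of the cell, not a published result; no definition is introduced; nothing is cited as a
fact.  ASSEMBLY of three typed ingredients: (i) row 9's heat-bath theorems
(`HeatBathSweepErgodic.lean`: `heatBathSweep_minorised` — the single-site heat-bath scan over a
list visiting every site dominates `(m/M)^{|l|} · ⊗μ` from EVERY configuration;
`heatBathSweep_invariant`; `WilsonHeatBathErgodic.lean`: the torus Wilson weight
`wilsonWeight ρ β = e^{−β S_W} · ⊗ Haar` of `Literature…ConstructiveQFTWave0` is such a bounded
Gibbs density by compactness); (ii) GEN-16's ergodicity criterion for stationary Markov chains in
measure form (`NCMCGeneralSpaceMarkovErgodicCriteria.ergodic_shift_chain_of_measure_le`); (iii) the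
restart chain of a Crooks pair (`NCMCGeneralSpaceMarkovRun`).

## Content

* §1 (any Crooks pair, any `ν₀`-invariant level sampler `K` minorised by a non-zero finite
  measure `m ≤ K(z, ·)`): **`CrooksPair.ergodic_restartChain_of_measure_le`**,
  **`CrooksPair.tendsto_jarzynskiEstimate_ae_restartChain_of_measure_le`**.
* §2 (any finite product of probability spaces, joint density `0 < m ≤ p ≤ M < ∞`, heat-bath scan
  `K = cycle (l.map (siteHeatBath μ p))` over a list `l` visiting every site, any Crooks pair out
  of the weight `p · ⊗μ`): **`CrooksPair.tendsto_jarzynskiEstimate_ae_heatBathRestart`** — along the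
  equilibrium restart chain driven by the heat-bath sweep, `ΔF̂_n → ΔF` almost surely.
* §3 THE ENGINE INSTANCE (`latflow-snf` with `updates.sweep(…, 'hb')` between launches, `G`
  compact second-countable — `SU(2)`, `U(1)` —, continuous representation `ρ`, any `β`, `d`, `L`, any
  edge order visiting every edge): **`CrooksPair.tendsto_jarzynskiEstimate_ae_wilsonHeatBathRestart`**
  — for EVERY Crooks pair whose prior weight is the torus Wilson weight `wilsonWeight ρ β` (Jarzynski
  in `β`, boundary-condition / defect protocols, SNF layers — anything certified as a Crooks pair),
  the Jarzynski free-energy estimate computed from forward evolutions launched off ONE equilibrium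
  heat-bath chain converges to `ΔF` almost surely, with no independence between the evolutions.

NOT CLAIMED: a rate (row 9's `ε = e^{−(sup βS_W − inf βS_W)|l|}` is qualitative); over-relaxation
interleaving (row 9's `…_comp_uniformlyErgodic` pattern would carry over: a `ν₀`-invariant `η`
after the sweep keeps the minorisation — not typed here); SU(3) pseudo-heat-bath (Cabibbo–Marinari,
`CabibboMarinariLatticeErgodic.latSweep_minorised` is the analogous input — not assembled here);
error bars.
-/

namespace Summit.Ventures.LatticeQCDFlow.Exactness.GeneralNCMC

open MeasureTheory ProbabilityTheory Set Filter Finset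
open scoped ENNReal Topology

/-! ## §1 Restart chains minorised by a measure -/

namespace CrooksPair

variable {Ω E : Type*} [MeasurableSpace Ω] [MeasurableSpace E]
variable {ν₀ ν₁ : Measure Ω} {κF κR : Kernel Ω E} {s e : E → Ω} {W : E → ℝ}

/-- **The equilibrium restart chain is ergodic when the level sampler is minorised by a non-zero
finite measure** (`m ≤ K(z, ·)` for all `z`). -/
theorem ergodic_restartChain_of_measure_le (K : Kernel Ω Ω) [IsMarkovKernel K] [IsFiniteMeasure ν₀]
    [IsMarkovKernel κF] (h0 : ν₀ univ ≠ 0) (hK : Kernel.Invariant K ν₀)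
    (h : CrooksPair ν₀ ν₁ κF κR s e W) {m : Measure Ω} [IsFiniteMeasure m] (hm0 : m univ ≠ 0)
    (hmin : ∀ z, m ≤ K z) :
    haveI := isProbabilityMeasure_fwdPathLaw ν₀ h0 κF
    Ergodic (fun (x : ℕ → E) (k : ℕ) => x (k + 1))
      (Kernel.trajMeasure (X := fun _ : ℕ => E) (fwdPathLaw ν₀ κF)
        (fun n : ℕ => ((κF ∘ₖ K).comap s h.measurable_s).comap
          (fun hh : (j : ↥(Finset.Iic n)) → E => hh ⟨n, Finset.mem_Iic.2 le_rfl⟩)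
          (measurable_pi_apply _))) := by
  haveI := isProbabilityMeasure_fwdPathLaw ν₀ h0 κF
  haveI : IsFiniteMeasure (m.bind κF) := inferInstance
  exact ergodic_shift_chain_of_measure_le _ (h.invariant_restartKernel K hK) (m := m.bind κF)
    (by rw [bind_apply_univ_of_markov]; exact hm0) (measure_le_comp_comap K κF h.measurable_s hmin)

/-- **`ΔF̂_n → ΔF` almost surely along the restart chain of a measure-minorised level sampler.** -/
theorem tendsto_jarzynskiEstimate_ae_restartChain_of_measure_le (K : Kernel Ω Ω)
    [IsMarkovKernel K] [IsFiniteMeasure ν₀] [IsFiniteMeasure ν₁] [IsMarkovKernel κF]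
    [IsMarkovKernel κR] (h0 : ν₀ univ ≠ 0) (hK : Kernel.Invariant K ν₀)
    (h : CrooksPair ν₀ ν₁ κF κR s e W) {ΔF : ℝ}
    (hΔF : Real.exp (-ΔF) = ((ν₀ univ)⁻¹ * ν₁ univ).toReal) {m : Measure Ω} [IsFiniteMeasure m]
    (hm0 : m univ ≠ 0) (hmin : ∀ z, m ≤ K z) :
    haveI := isProbabilityMeasure_fwdPathLaw ν₀ h0 κF
    ∀ᵐ x ∂(Kernel.trajMeasure (X := fun _ : ℕ => E) (fwdPathLaw ν₀ κF)
        (fun n : ℕ => ((κF ∘ₖ K).comap s h.measurable_s).comap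
          (fun hh : (j : ↥(Finset.Iic n)) → E => hh ⟨n, Finset.mem_Iic.2 le_rfl⟩)
          (measurable_pi_apply _))),
      Tendsto (fun n : ℕ => jarzynskiEstimate (fun ε => Real.exp (-W ε)) (fun i : Fin n => x i))
        atTop (𝓝 ΔF) :=
  h.tendsto_jarzynskiEstimate_ae_restartChain K h0 hK hΔF
    (h.ergodic_restartChain_of_measure_le K h0 hK hm0 hmin)

end CrooksPair

/-! ## §2 The heat-bath sweep of a bounded Gibbs density as level sampler -/

section HeatBath

variable {ι : Type*} [Fintype ι] [DecidableEq ι] {X : ι → Type*} [∀ i, MeasurableSpace (X i)]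
variable {μ : Π i, Measure (X i)} [∀ i, IsProbabilityMeasure (μ i)] {p : (Π j, X j) → ℝ≥0∞}
variable {m M : ℝ≥0∞}

omit [DecidableEq ι] in
/-- The weight `p · ⊗μ` of a density bounded by `M < ∞` is a finite measure. -/
theorem isFiniteMeasure_pi_withDensity (hMtop : M ≠ ∞) (hpM : ∀ ω, p ω ≤ M) :
    IsFiniteMeasure ((Measure.pi μ).withDensity p) := by
  refine isFiniteMeasure_withDensity (ne_top_of_le_ne_top (by simpa using hMtop) ?_)
  calc ∫⁻ ω, p ω ∂Measure.pi μ ≤ ∫⁻ _, M ∂Measure.pi μ := lintegral_mono fun ω => hpM ω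
    _ = M := by rw [lintegral_const, measure_univ, mul_one]

omit [DecidableEq ι] in
/-- The weight `p · ⊗μ` of a density bounded below by `m > 0` is non-zero. -/
theorem pi_withDensity_univ_ne_zero (hm0 : m ≠ 0) (hmp : ∀ ω, m ≤ p ω) :
    (Measure.pi μ).withDensity p univ ≠ 0 := by
  rw [withDensity_apply _ MeasurableSet.univ, Measure.restrict_univ]
  refine (lt_of_lt_of_le (pos_iff_ne_zero.2 hm0) ?_).ne'
  calc m = ∫⁻ _, m ∂Measure.pi μ := by rw [lintegral_const, measure_univ, mul_one]
    _ ≤ _ := lintegral_mono fun ω => hmp ω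

/-- **Heat-bath restart chains are ergodic; `ΔF̂_n → ΔF` almost surely.**  For a joint density
`0 < m ≤ p ≤ M < ∞` on a finite product of probability spaces, a heat-bath scan over a list visiting
every site as the level sampler, and ANY Crooks pair out of the weight `p · ⊗μ`: along the
equilibrium restart chain of forward records the Jarzynski estimate converges to `ΔF` a.s. -/
theorem CrooksPair.tendsto_jarzynskiEstimate_ae_heatBathRestart (hp : Measurable p) (hm0 : m ≠ 0)
    (hMtop : M ≠ ∞) (hmp : ∀ ω, m ≤ p ω) (hpM : ∀ ω, p ω ≤ M) {l : List ι} (hl : ∀ i, i ∈ l)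
    {E : Type*} [MeasurableSpace E] {ν₁ : Measure (Π j, X j)} [IsFiniteMeasure ν₁]
    {κF κR : Kernel (Π j, X j) E} [IsMarkovKernel κF] [IsMarkovKernel κR]
    {s e : E → Π j, X j} {W : E → ℝ}
    (h : CrooksPair ((Measure.pi μ).withDensity p) ν₁ κF κR s e W) {ΔF : ℝ}
    (hΔF : Real.exp (-ΔF) = ((((Measure.pi μ).withDensity p) univ)⁻¹ * ν₁ univ).toReal) :
    haveI := isMarkovKernel_heatBathSweep (μ := μ) hp hm0 hMtop hmp hpM l
    haveI := isFiniteMeasure_pi_withDensity (μ := μ) hMtop hpM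
    haveI := isProbabilityMeasure_fwdPathLaw ((Measure.pi μ).withDensity p)
      (pi_withDensity_univ_ne_zero hm0 hmp) κF
    ∀ᵐ x ∂(Kernel.trajMeasure (X := fun _ : ℕ => E) (fwdPathLaw ((Measure.pi μ).withDensity p) κF)
        (fun n : ℕ => ((κF ∘ₖ cycle (l.map (siteHeatBath μ p))).comap s h.measurable_s).comap
          (fun hh : (j : ↥(Finset.Iic n)) → E => hh ⟨n, Finset.mem_Iic.2 le_rfl⟩)
          (measurable_pi_apply _))),
      Tendsto (fun n : ℕ => jarzynskiEstimate (fun ε => Real.exp (-W ε)) (fun i : Fin n => x i))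
        atTop (𝓝 ΔF) := by
  haveI := isMarkovKernel_heatBathSweep (μ := μ) hp hm0 hMtop hmp hpM l
  haveI := isFiniteMeasure_pi_withDensity (μ := μ) hMtop hpM
  have hp_top : ∀ ω, p ω ≠ ∞ := fun ω => ne_top_of_le_ne_top hMtop (hpM ω)
  have hZ : ∀ i ω, siteNorm μ p i ω ≠ 0 := fun i ω =>
    (lt_of_lt_of_le (pos_iff_ne_zero.2 hm0) (le_siteNorm hmp i ω)).ne'
  have hZtop : ∀ i ω, siteNorm μ p i ω ≠ ∞ := fun i ω =>
    ne_top_of_le_ne_top hMtop (siteNorm_le hpM i ω)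
  have hK : Kernel.Invariant (cycle (l.map (siteHeatBath μ p))) ((Measure.pi μ).withDensity p) :=
    heatBathSweep_invariant hp hp_top hZ hZtop l
  -- the minorising measure `(m/M)^{|l|} · ⊗μ` is finite and non-zero
  have hM0 : M ≠ 0 := by
    obtain ⟨ω⟩ : Nonempty (Π j, X j) := ⟨fun i => (nonempty_of_isProbabilityMeasure (μ i)).some⟩
    exact (lt_of_lt_of_le (pos_iff_ne_zero.2 hm0) ((hmp ω).trans (hpM ω))).ne'
  have hmtop : m ≠ ∞ := by
    obtain ⟨ω⟩ : Nonempty (Π j, X j) := ⟨fun i => (nonempty_of_isProbabilityMeasure (μ i)).some⟩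
    exact ne_top_of_le_ne_top hMtop ((hmp ω).trans (hpM ω))
  have hc_top : (m * M⁻¹) ^ l.length ≠ ∞ :=
    ENNReal.pow_ne_top (ENNReal.mul_ne_top hmtop (ENNReal.inv_ne_top.2 hM0))
  have hc0 : (m * M⁻¹) ^ l.length ≠ 0 :=
    pow_ne_zero _ (mul_ne_zero hm0 (ENNReal.inv_ne_zero.2 hMtop))
  haveI : IsFiniteMeasure ((m * M⁻¹) ^ l.length • Measure.pi μ) := Measure.smul_finite _ hc_top
  have hmu : ((m * M⁻¹) ^ l.length • Measure.pi μ) univ ≠ 0 := by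
    rw [Measure.smul_apply, smul_eq_mul, measure_univ, mul_one]
    exact hc0
  exact h.tendsto_jarzynskiEstimate_ae_restartChain_of_measure_le (cycle (l.map (siteHeatBath μ p)))
    (pi_withDensity_univ_ne_zero hm0 hmp) hK hΔF hmu (heatBathSweep_minorised hp hm0 hMtop hmp hpM hl)

end HeatBath

/-! ## §3 The engine instance: the torus Wilson theory with the heat-bath link sweep -/

section Wilson

open Literature.MathematicalPhysics.QuantumFieldTheory

variable {d L N : ℕ} {G : Type*} [Group G] [TopologicalSpace G] [IsTopologicalGroup G]
  (ρ : G →* Matrix (Fin N) (Fin N) ℂ) [CompactSpace G] [MeasurableSpace G] [BorelSpace G]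
  [SecondCountableTopology G]

omit [SecondCountableTopology G] in
/-- The torus Wilson weight is row 9's bounded Gibbs weight of the product Haar reference. -/
theorem wilsonWeight_eq_pi_withDensity [NeZero L] (β : ℝ) :
    wilsonWeight (d := d) (L := L) ρ β =
      (Measure.pi fun _ : Edge d L => haarProbability G).withDensity
        (gibbsDensity fun U : GaugeConfig d L G => β * wilsonAction ρ U) := by
  have hdens : (fun U : GaugeConfig d L G => ENNReal.ofReal (Real.exp (-β * wilsonAction ρ U))) =
      gibbsDensity fun U : GaugeConfig d L G => β * wilsonAction ρ U := by
    funext U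
    rw [gibbsDensity, neg_mul]
  rw [wilsonWeight, hdens]

/-- **THE ENGINE INSTANCE.**  Torus Wilson theory (`G` compact second countable, `ρ` continuous,
any `β`, `d`, `L ≠ 0`), level sampler = the single-link heat-bath scan over any list of edges
visiting every edge; for EVERY Crooks pair whose prior weight is `wilsonWeight ρ β` and every
`ΔF` with `e^{−ΔF} = Z₁/Z₀`: along the equilibrium restart chain of forward evolutions the
Jarzynski estimate converges to `ΔF` ALMOST SURELY. -/
theorem CrooksPair.tendsto_jarzynskiEstimate_ae_wilsonHeatBathRestart [NeZero L] (hρ : Continuous ρ)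
    (β : ℝ) {l : List (Edge d L)} (hl : ∀ ed, ed ∈ l) {E : Type*} [MeasurableSpace E]
    {ν₁ : Measure (GaugeConfig d L G)} [IsFiniteMeasure ν₁]
    {κF κR : Kernel (GaugeConfig d L G) E} [IsMarkovKernel κF] [IsMarkovKernel κR]
    {s e : E → GaugeConfig d L G} {W : E → ℝ}
    (h : CrooksPair (wilsonWeight (d := d) (L := L) ρ β) ν₁ κF κR s e W) {ΔF : ℝ}
    (hΔF : Real.exp (-ΔF) = (((wilsonWeight (d := d) (L := L) ρ β) univ)⁻¹ * ν₁ univ).toReal) :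
    ∃ (_ : IsMarkovKernel (cycle (l.map (siteHeatBath (fun _ : Edge d L => haarProbability G)
        (gibbsDensity fun U : GaugeConfig d L G => β * wilsonAction ρ U)))))
      (_ : IsProbabilityMeasure (fwdPathLaw (wilsonWeight (d := d) (L := L) ρ β) κF)),
    ∀ᵐ x ∂(Kernel.trajMeasure (X := fun _ : ℕ => E) (fwdPathLaw (wilsonWeight (d := d) (L := L) ρ β) κF)
        (fun n : ℕ => ((κF ∘ₖ cycle (l.map (siteHeatBath (fun _ : Edge d L => haarProbability G)
          (gibbsDensity fun U : GaugeConfig d L G => β * wilsonAction ρ U)))).comap s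
            h.measurable_s).comap
          (fun hh : (j : ↥(Finset.Iic n)) → E => hh ⟨n, Finset.mem_Iic.2 le_rfl⟩)
          (measurable_pi_apply _))),
      Tendsto (fun n : ℕ => jarzynskiEstimate (fun ε => Real.exp (-W ε)) (fun i : Fin n => x i))
        atTop (𝓝 ΔF) := by
  -- bounds on the continuous action over the compact configuration space
  have hS : Continuous fun U : GaugeConfig d L G => β * wilsonAction ρ U :=
    continuous_smul_wilsonAction ρ hρ β
  haveI : Nonempty (GaugeConfig d L G) := ⟨fun _ => 1⟩
  obtain ⟨ωa, -, hmin⟩ := isCompact_univ.exists_isMinOn Set.univ_nonempty hS.continuousOn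
  obtain ⟨ωb, -, hmax⟩ := isCompact_univ.exists_isMaxOn Set.univ_nonempty hS.continuousOn
  have hωa : ∀ U, β * wilsonAction ρ ωa ≤ β * wilsonAction ρ U :=
    fun U => (isMinOn_iff.1 hmin) U (Set.mem_univ U)
  have hωb : ∀ U, β * wilsonAction ρ U ≤ β * wilsonAction ρ ωb :=
    fun U => (isMaxOn_iff.1 hmax) U (Set.mem_univ U)
  have hm0 : ENNReal.ofReal (Real.exp (-(β * wilsonAction ρ ωb))) ≠ 0 := by
    rw [Ne, ENNReal.ofReal_eq_zero, not_le]; exact Real.exp_pos _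
  have hp := measurable_gibbsDensity hS
  have key := CrooksPair.tendsto_jarzynskiEstimate_ae_heatBathRestart
    (μ := fun _ : Edge d L => haarProbability G) hp hm0 ENNReal.ofReal_ne_top
    (fun ω => (gibbsDensity_bounds hωa hωb ω).1) (fun ω => (gibbsDensity_bounds hωa hωb ω).2) hl
    (ν₁ := ν₁) (κF := κF) (κR := κR) (s := s) (e := e) (W := W)
    (by rw [← wilsonWeight_eq_pi_withDensity]; exact h) (ΔF := ΔF)
    (by rw [← wilsonWeight_eq_pi_withDensity]; exact hΔF)
  refine ⟨isMarkovKernel_heatBathSweep (μ := fun _ : Edge d L => haarProbability G) hp hm0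
    ENNReal.ofReal_ne_top (fun ω => (gibbsDensity_bounds hωa hωb ω).1)
    (fun ω => (gibbsDensity_bounds hωa hωb ω).2) l, ?_, ?_⟩
  · rw [wilsonWeight_eq_pi_withDensity]
    haveI := isFiniteMeasure_pi_withDensity (μ := fun _ : Edge d L => haarProbability G)
      ENNReal.ofReal_ne_top (fun ω => (gibbsDensity_bounds hωa hωb ω).2)
    exact isProbabilityMeasure_fwdPathLaw _
      (pi_withDensity_univ_ne_zero hm0 (fun ω => (gibbsDensity_bounds hωa hωb ω).1)) κF
  · convert key using 3; rw [wilsonWeight_eq_pi_withDensity]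

end Wilson

end Summit.Ventures.LatticeQCDFlow.Exactness.GeneralNCMC
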